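import Mathlib
import Summits.Ventures.PercRepro2.CoinOrTailAlg
import Summits.Ventures.PercRepro2.CoinOrTailBlockSums
import Summits.Ventures.PercRepro2.CoinOrTailKDefs
import Summits.Ventures.PercRepro2.CoinOrTailKSums
import Summits.Ventures.PercRepro2.CoinOrTailKCore
import Summits.Ventures.PercRepro2.CoinK2HeadBlindVals

/-!
# Two incomparable uncovered entries, head-blind: the entry-state sums
(blind cell PercRepro2, night-2 g12; proofs/NIGHT2-DARC.md §47.4)

The lattice steps of the four sublattice pieces of a log-supermodular weight `G` on the cluster
lattice (the principal ideal `{r₁, r₂ ∉ W}`: lsm and Holley-BELOW `G`; the principal filters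
`[r]`, `[r₁r₂]`: lsm and Holley-ABOVE `G` — `ideal_*`, `filter_*`, `top_*`), the values of
`ν · rValK` / `ν · gValK` on the three entry states under sure coins and head-blindness
(`rval_cell_*`, `gval_cell_*`), and the ENTRY-STATE DECOMPOSITION of the marker-block sums
(`R_blocks_eq`, `G_blocks_eq`): `Λ_b = a_b + α₁n₁(b) + α₂n₂(b) + α₁₂n₁₂(b)` and
`M_b = a_b + β₁n₁(b) + β₂n₂(b) + β₁₂n₁₂(b)`.
-/

namespace Summit.Ventures.PercRepro2.Coin

open Classical

section K2Lattice

variable {V : Type*} [DecidableEq V] {R : Type*} [Field R] [LinearOrder R] [IsStrictOrderedRing R]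

/-- The ideal piece `G · 1[r₁, r₂ ∉ W]` of a log-supermodular weight is log-supermodular. -/
lemma ideal_lsm (U : Finset V) (G : Finset V → R) (r₁ r₂ : V) (hG0 : ∀ W, 0 ≤ G W)
    (hG : ∀ s ⊆ U, ∀ t ⊆ U, G s * G t ≤ G (s ∩ t) * G (s ∪ t)) :
    ∀ s ⊆ U, ∀ t ⊆ U, G s * cellWt r₁ r₂ false false s * (G t * cellWt r₁ r₂ false false t) ≤
      G (s ∩ t) * cellWt r₁ r₂ false false (s ∩ t) *
        (G (s ∪ t) * cellWt r₁ r₂ false false (s ∪ t)) := by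
  intro s hs t ht
  have h1 := hG s hs t ht
  have h2 := cellWt_mul_le (R := R) r₁ r₂ false false false false s t
  simp only [Bool.and_self, Bool.or_self] at h2
  calc G s * cellWt r₁ r₂ false false s * (G t * cellWt r₁ r₂ false false t)
      = (G s * G t) * (cellWt r₁ r₂ false false s * cellWt r₁ r₂ false false t) := by ring
    _ ≤ (G (s ∩ t) * G (s ∪ t)) *
          (cellWt r₁ r₂ false false (s ∩ t) * cellWt r₁ r₂ false false (s ∪ t)) :=
        mul_le_mul h1 h2 (mul_nonneg (cellWt_nonneg _ _ _ _ _) (cellWt_nonneg _ _ _ _ _))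
          (mul_nonneg (hG0 _) (hG0 _))
    _ = _ := by ring

/-- The ideal piece is Holley-BELOW `G`. -/
lemma ideal_below (U : Finset V) (G : Finset V → R) (r₁ r₂ : V) (hG0 : ∀ W, 0 ≤ G W)
    (hG : ∀ s ⊆ U, ∀ t ⊆ U, G s * G t ≤ G (s ∩ t) * G (s ∪ t)) :
    ∀ s ⊆ U, ∀ t ⊆ U, G s * (G t * cellWt r₁ r₂ false false t) ≤
      G (s ∩ t) * cellWt r₁ r₂ false false (s ∩ t) * G (s ∪ t) := by
  intro s hs t ht
  have h1 := hG s hs t ht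
  have h2 : cellWt (R := R) r₁ r₂ false false t ≤ cellWt r₁ r₂ false false (s ∩ t) := by
    unfold cellWt mWt
    by_cases a1 : r₁ ∈ t <;> by_cases a2 : r₂ ∈ t <;>
      simp [a1, a2, Finset.mem_inter] <;> split_ifs <;> norm_num
  calc G s * (G t * cellWt r₁ r₂ false false t)
      = (G s * G t) * cellWt r₁ r₂ false false t := by ring
    _ ≤ (G (s ∩ t) * G (s ∪ t)) * cellWt r₁ r₂ false false (s ∩ t) :=
        mul_le_mul h1 h2 (cellWt_nonneg _ _ _ _ _) (mul_nonneg (hG0 _) (hG0 _))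
    _ = _ := by ring

/-- The top piece `G · 1[r₁, r₂ ∈ W]` is log-supermodular. -/
lemma top_lsm (U : Finset V) (G : Finset V → R) (r₁ r₂ : V) (hG0 : ∀ W, 0 ≤ G W)
    (hG : ∀ s ⊆ U, ∀ t ⊆ U, G s * G t ≤ G (s ∩ t) * G (s ∪ t)) :
    ∀ s ⊆ U, ∀ t ⊆ U, G s * cellWt r₁ r₂ true true s * (G t * cellWt r₁ r₂ true true t) ≤
      G (s ∩ t) * cellWt r₁ r₂ true true (s ∩ t) * (G (s ∪ t) * cellWt r₁ r₂ true true (s ∪ t)) := by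
  intro s hs t ht
  have h1 := hG s hs t ht
  have h2 := cellWt_mul_le (R := R) r₁ r₂ true true true true s t
  simp only [Bool.and_self, Bool.or_self] at h2
  calc G s * cellWt r₁ r₂ true true s * (G t * cellWt r₁ r₂ true true t)
      = (G s * G t) * (cellWt r₁ r₂ true true s * cellWt r₁ r₂ true true t) := by ring
    _ ≤ (G (s ∩ t) * G (s ∪ t)) *
          (cellWt r₁ r₂ true true (s ∩ t) * cellWt r₁ r₂ true true (s ∪ t)) :=
        mul_le_mul h1 h2 (mul_nonneg (cellWt_nonneg _ _ _ _ _) (cellWt_nonneg _ _ _ _ _))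
          (mul_nonneg (hG0 _) (hG0 _))
    _ = _ := by ring

/-- The top piece is Holley-ABOVE `G`. -/
lemma top_above (U : Finset V) (G : Finset V → R) (r₁ r₂ : V) (hG0 : ∀ W, 0 ≤ G W)
    (hG : ∀ s ⊆ U, ∀ t ⊆ U, G s * G t ≤ G (s ∩ t) * G (s ∪ t)) :
    ∀ s ⊆ U, ∀ t ⊆ U, G s * cellWt r₁ r₂ true true s * G t ≤
      G (s ∩ t) * (G (s ∪ t) * cellWt r₁ r₂ true true (s ∪ t)) := by
  intro s hs t ht
  have h1 := hG s hs t ht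
  have h2 : cellWt (R := R) r₁ r₂ true true s ≤ cellWt r₁ r₂ true true (s ∪ t) := by
    unfold cellWt mWt
    by_cases a1 : r₁ ∈ s <;> by_cases a2 : r₂ ∈ s <;>
      simp [a1, a2, Finset.mem_union] <;> split_ifs <;> norm_num
  calc G s * cellWt r₁ r₂ true true s * G t = (G s * G t) * cellWt r₁ r₂ true true s := by ring
    _ ≤ (G (s ∩ t) * G (s ∪ t)) * cellWt r₁ r₂ true true (s ∪ t) :=
        mul_le_mul h1 h2 (cellWt_nonneg _ _ _ _ _) (mul_nonneg (hG0 _) (hG0 _))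
    _ = _ := by ring

/-- The filter piece `G · 1[r ∈ W]` is log-supermodular. -/
lemma filter_lsm (U : Finset V) (G : Finset V → R) (r : V) (hG0 : ∀ W, 0 ≤ G W)
    (hG : ∀ s ⊆ U, ∀ t ⊆ U, G s * G t ≤ G (s ∩ t) * G (s ∪ t)) :
    ∀ s ⊆ U, ∀ t ⊆ U, G s * mWt r true s * (G t * mWt r true t) ≤
      G (s ∩ t) * mWt r true (s ∩ t) * (G (s ∪ t) * mWt r true (s ∪ t)) := by
  intro s hs t ht
  have h1 := hG s hs t ht
  have h2 := mWt_mul_le (R := R) r true true s t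
  simp only [Bool.and_self, Bool.or_self] at h2
  calc G s * mWt r true s * (G t * mWt r true t)
      = (G s * G t) * (mWt r true s * mWt r true t) := by ring
    _ ≤ (G (s ∩ t) * G (s ∪ t)) * (mWt r true (s ∩ t) * mWt r true (s ∪ t)) :=
        mul_le_mul h1 h2 (mul_nonneg (mWt_nonneg _ _ _) (mWt_nonneg _ _ _))
          (mul_nonneg (hG0 _) (hG0 _))
    _ = _ := by ring

/-- The filter piece is Holley-ABOVE `G`. -/
lemma filter_above (U : Finset V) (G : Finset V → R) (r : V) (hG0 : ∀ W, 0 ≤ G W)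
    (hG : ∀ s ⊆ U, ∀ t ⊆ U, G s * G t ≤ G (s ∩ t) * G (s ∪ t)) :
    ∀ s ⊆ U, ∀ t ⊆ U, G s * mWt r true s * G t ≤ G (s ∩ t) * (G (s ∪ t) * mWt r true (s ∪ t)) := by
  intro s hs t ht
  have h1 := hG s hs t ht
  have h2 : mWt (R := R) r true s ≤ mWt r true (s ∪ t) := by
    unfold mWt
    by_cases a1 : r ∈ s
    · simp [a1, Finset.mem_union]
    · simp [a1, Finset.mem_union]
      split_ifs <;> norm_num
  calc G s * mWt r true s * G t = (G s * G t) * mWt r true s := by ring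
    _ ≤ (G (s ∩ t) * G (s ∪ t)) * mWt r true (s ∪ t) :=
        mul_le_mul h1 h2 (mWt_nonneg _ _ _) (mul_nonneg (hG0 _) (hG0 _))
    _ = _ := by ring

omit [LinearOrder R] [IsStrictOrderedRing R] in
/-- Membership from a nonzero cell weight. -/
lemma of_cell_tf {r₁ r₂ : V} {W : Finset V} (h : cellWt (R := R) r₁ r₂ true false W ≠ 0) :
    r₁ ∈ W ∧ r₂ ∉ W := by
  obtain ⟨h1, h2⟩ := of_cellWt_ne_zero h
  exact ⟨h1.2 rfl, fun hh => Bool.false_ne_true (h2.1 hh)⟩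

omit [LinearOrder R] [IsStrictOrderedRing R] in
/-- Membership from a nonzero cell weight. -/
lemma of_cell_ft {r₁ r₂ : V} {W : Finset V} (h : cellWt (R := R) r₁ r₂ false true W ≠ 0) :
    r₁ ∉ W ∧ r₂ ∈ W := by
  obtain ⟨h1, h2⟩ := of_cellWt_ne_zero h
  exact ⟨fun hh => Bool.false_ne_true (h1.1 hh), h2.2 rfl⟩

omit [LinearOrder R] [IsStrictOrderedRing R] in
/-- Membership from a nonzero cell weight. -/
lemma of_cell_tt {r₁ r₂ : V} {W : Finset V} (h : cellWt (R := R) r₁ r₂ true true W ≠ 0) :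
    r₁ ∈ W ∧ r₂ ∈ W := by
  obtain ⟨h1, h2⟩ := of_cellWt_ne_zero h
  exact ⟨h1.2 rfl, h2.2 rfl⟩

omit [LinearOrder R] [IsStrictOrderedRing R] in
/-- Membership from a nonzero cell weight. -/
lemma of_cell_ff {r₁ r₂ : V} {W : Finset V} (h : cellWt (R := R) r₁ r₂ false false W ≠ 0) :
    r₁ ∉ W ∧ r₂ ∉ W := by
  obtain ⟨h1, h2⟩ := of_cellWt_ne_zero h
  exact ⟨fun hh => Bool.false_ne_true (h1.1 hh), fun hh => Bool.false_ne_true (h2.1 hh)⟩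

end K2Lattice

section K2StateSums

variable {V : Type*} {E : Type*} [DecidableEq V] {R : Type*} [Field R]

/-- The entry-state sum of a weight times a value that is constant on the state. -/
lemma state_sum_eq (U : Finset V) (ν : Finset V → R) (val : R) (r₁ r₂ m₁ m₂ : V)
    (e₁ e₂ b₁ b₂ : Bool) (f : Finset V → R)
    (hf : ∀ W ∈ U.powerset, f W * cellWt r₁ r₂ e₁ e₂ W = val * (ν W * cellWt r₁ r₂ e₁ e₂ W)) :
    (∑ W ∈ U.powerset, f W * cellWt m₁ m₂ b₁ b₂ W * cellWt r₁ r₂ e₁ e₂ W) =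
      val * ∑ W ∈ U.powerset, ν W * cellWt r₁ r₂ e₁ e₂ W * cellWt m₁ m₂ b₁ b₂ W := by
  rw [Finset.mul_sum]
  refine Finset.sum_congr rfl fun W hW => ?_
  have := hf W hW
  calc f W * cellWt m₁ m₂ b₁ b₂ W * cellWt r₁ r₂ e₁ e₂ W
      = (f W * cellWt r₁ r₂ e₁ e₂ W) * cellWt m₁ m₂ b₁ b₂ W := by ring
    _ = val * (ν W * cellWt r₁ r₂ e₁ e₂ W) * cellWt m₁ m₂ b₁ b₂ W := by rw [this]
    _ = val * (ν W * cellWt r₁ r₂ e₁ e₂ W * cellWt m₁ m₂ b₁ b₂ W) := by ring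

/-- The `R`-weight on the state `(true, false)`: the value `A({r₁} ∪ {a})`. -/
lemma rval_cell_tf (U : Finset V) (ν A : Finset V → R) (pr : E → R) (ent : Finset V) (c : V → E)
    (r₁ r₂ a w : V) (hsure : ∀ r ∈ ent, pr (c r) = 1) (hr₁ : r₁ ∈ ent)
    (hent : ∀ r ∈ ent, r = r₁ ∨ r = r₂)
    (hblind : ∀ W ⊆ U, ∀ X ⊆ ({a, w} : Finset V), A (W ∪ X) = A (W ∩ ent ∪ X)) :
    ∀ W ∈ U.powerset, ν W * rValK A pr ent c a W * cellWt r₁ r₂ true false W =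
      A ({r₁} ∪ {a}) * (ν W * cellWt r₁ r₂ true false W) := by
  intro W hW
  by_cases h : cellWt (R := R) r₁ r₂ true false W = 0
  · rw [h]; ring
  · obtain ⟨h1, h2⟩ := of_cell_tf h
    have e : rValK A pr ent c a W = A ({r₁} ∪ {a}) := by
      rw [rValK_sure_of_entry A pr c a hsure ⟨r₁, hr₁, h1⟩,
        hblind W (Finset.mem_powerset.1 hW) {a} (Finset.singleton_subset_iff.2 (by simp)),
        inter_ent_tf hent hr₁ h1 h2]
    rw [e]; ring

/-- The `R`-weight on the state `(false, true)`: the value `A({r₂} ∪ {a})`. -/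
lemma rval_cell_ft (U : Finset V) (ν A : Finset V → R) (pr : E → R) (ent : Finset V) (c : V → E)
    (r₁ r₂ a w : V) (hsure : ∀ r ∈ ent, pr (c r) = 1) (hr₂ : r₂ ∈ ent)
    (hent : ∀ r ∈ ent, r = r₁ ∨ r = r₂)
    (hblind : ∀ W ⊆ U, ∀ X ⊆ ({a, w} : Finset V), A (W ∪ X) = A (W ∩ ent ∪ X)) :
    ∀ W ∈ U.powerset, ν W * rValK A pr ent c a W * cellWt r₁ r₂ false true W =
      A ({r₂} ∪ {a}) * (ν W * cellWt r₁ r₂ false true W) := by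
  intro W hW
  by_cases h : cellWt (R := R) r₁ r₂ false true W = 0
  · rw [h]; ring
  · obtain ⟨h1, h2⟩ := of_cell_ft h
    have e : rValK A pr ent c a W = A ({r₂} ∪ {a}) := by
      rw [rValK_sure_of_entry A pr c a hsure ⟨r₂, hr₂, h2⟩,
        hblind W (Finset.mem_powerset.1 hW) {a} (Finset.singleton_subset_iff.2 (by simp)),
        inter_ent_ft hent hr₂ h1 h2]
    rw [e]; ring

/-- The `R`-weight on the state `(true, true)`: the value `A(ent ∪ {a})`. -/
lemma rval_cell_tt (U : Finset V) (ν A : Finset V → R) (pr : E → R) (ent : Finset V) (c : V → E)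
    (r₁ r₂ a w : V) (hsure : ∀ r ∈ ent, pr (c r) = 1) (hr₁ : r₁ ∈ ent)
    (hent : ∀ r ∈ ent, r = r₁ ∨ r = r₂)
    (hblind : ∀ W ⊆ U, ∀ X ⊆ ({a, w} : Finset V), A (W ∪ X) = A (W ∩ ent ∪ X)) :
    ∀ W ∈ U.powerset, ν W * rValK A pr ent c a W * cellWt r₁ r₂ true true W =
      A (ent ∪ {a}) * (ν W * cellWt r₁ r₂ true true W) := by
  intro W hW
  by_cases h : cellWt (R := R) r₁ r₂ true true W = 0
  · rw [h]; ring
  · obtain ⟨h1, h2⟩ := of_cell_tt h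
    have e : rValK A pr ent c a W = A (ent ∪ {a}) := by
      rw [rValK_sure_of_entry A pr c a hsure ⟨r₁, hr₁, h1⟩,
        hblind W (Finset.mem_powerset.1 hW) {a} (Finset.singleton_subset_iff.2 (by simp)),
        inter_ent_tt hent h1 h2]
    rw [e]; ring

/-- The gate weight on the state `(true, false)`: the value `A({r₁} ∪ {a, w})`. -/
lemma gval_cell_tf (U : Finset V) (ν A : Finset V → R) (pr : E → R) (ent : Finset V) (c : V → E)
    (r₁ r₂ a w : V) (hsure : ∀ r ∈ ent, pr (c r) = 1) (hr₁ : r₁ ∈ ent)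
    (hent : ∀ r ∈ ent, r = r₁ ∨ r = r₂)
    (hblind : ∀ W ⊆ U, ∀ X ⊆ ({a, w} : Finset V), A (W ∪ X) = A (W ∩ ent ∪ X)) :
    ∀ W ∈ U.powerset, ν W * gValK A pr ent c a w W * cellWt r₁ r₂ true false W =
      A ({r₁} ∪ {a, w}) * (ν W * cellWt r₁ r₂ true false W) := by
  intro W hW
  by_cases h : cellWt (R := R) r₁ r₂ true false W = 0
  · rw [h]; ring
  · obtain ⟨h1, h2⟩ := of_cell_tf h
    have e : gValK A pr ent c a w W = A ({r₁} ∪ {a, w}) := by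
      rw [gValK_sure_of_entry A pr c a w hsure ⟨r₁, hr₁, h1⟩,
        hblind W (Finset.mem_powerset.1 hW) {a, w} (subset_refl _), inter_ent_tf hent hr₁ h1 h2]
    rw [e]; ring

/-- The gate weight on the state `(false, true)`: the value `A({r₂} ∪ {a, w})`. -/
lemma gval_cell_ft (U : Finset V) (ν A : Finset V → R) (pr : E → R) (ent : Finset V) (c : V → E)
    (r₁ r₂ a w : V) (hsure : ∀ r ∈ ent, pr (c r) = 1) (hr₂ : r₂ ∈ ent)
    (hent : ∀ r ∈ ent, r = r₁ ∨ r = r₂)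
    (hblind : ∀ W ⊆ U, ∀ X ⊆ ({a, w} : Finset V), A (W ∪ X) = A (W ∩ ent ∪ X)) :
    ∀ W ∈ U.powerset, ν W * gValK A pr ent c a w W * cellWt r₁ r₂ false true W =
      A ({r₂} ∪ {a, w}) * (ν W * cellWt r₁ r₂ false true W) := by
  intro W hW
  by_cases h : cellWt (R := R) r₁ r₂ false true W = 0
  · rw [h]; ring
  · obtain ⟨h1, h2⟩ := of_cell_ft h
    have e : gValK A pr ent c a w W = A ({r₂} ∪ {a, w}) := by
      rw [gValK_sure_of_entry A pr c a w hsure ⟨r₂, hr₂, h2⟩,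
        hblind W (Finset.mem_powerset.1 hW) {a, w} (subset_refl _), inter_ent_ft hent hr₂ h1 h2]
    rw [e]; ring

/-- The gate weight on the state `(true, true)`: the value `A(ent ∪ {a, w})`. -/
lemma gval_cell_tt (U : Finset V) (ν A : Finset V → R) (pr : E → R) (ent : Finset V) (c : V → E)
    (r₁ r₂ a w : V) (hsure : ∀ r ∈ ent, pr (c r) = 1) (hr₁ : r₁ ∈ ent)
    (hent : ∀ r ∈ ent, r = r₁ ∨ r = r₂)
    (hblind : ∀ W ⊆ U, ∀ X ⊆ ({a, w} : Finset V), A (W ∪ X) = A (W ∩ ent ∪ X)) :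
    ∀ W ∈ U.powerset, ν W * gValK A pr ent c a w W * cellWt r₁ r₂ true true W =
      A (ent ∪ {a, w}) * (ν W * cellWt r₁ r₂ true true W) := by
  intro W hW
  by_cases h : cellWt (R := R) r₁ r₂ true true W = 0
  · rw [h]; ring
  · obtain ⟨h1, h2⟩ := of_cell_tt h
    have e : gValK A pr ent c a w W = A (ent ∪ {a, w}) := by
      rw [gValK_sure_of_entry A pr c a w hsure ⟨r₁, hr₁, h1⟩,
        hblind W (Finset.mem_powerset.1 hW) {a, w} (subset_refl _), inter_ent_tt hent h1 h2]
    rw [e]; ring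

/-- On the entry-free state the gate weight is the `R`-weight. -/
lemma gval_cell_ff (ν A : Finset V → R) (pr : E → R) (ent : Finset V) (c : V → E)
    (r₁ r₂ a w : V) (hent : ∀ r ∈ ent, r = r₁ ∨ r = r₂) (W : Finset V) :
    ν W * gValK A pr ent c a w W * cellWt r₁ r₂ false false W =
      ν W * rValK A pr ent c a W * cellWt r₁ r₂ false false W := by
  by_cases h : cellWt (R := R) r₁ r₂ false false W = 0
  · rw [h]; ring
  · obtain ⟨h1, h2⟩ := of_cell_ff h
    have hno : ∀ r ∈ ent, r ∉ W := by
      intro r hr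
      rcases hent r hr with rfl | rfl
      · exact h1
      · exact h2
    rw [gValK_eq_rValK_of_no_entry A pr c a w hno]

/-- **The entry-state decomposition of the `R`-law's marker-block sums.** -/
theorem R_blocks_eq (U : Finset V) (ν A : Finset V → R) (pr : E → R) (ent : Finset V) (c : V → E)
    (r₁ r₂ m₁ m₂ a w : V) (hsure : ∀ r ∈ ent, pr (c r) = 1) (hr₁ : r₁ ∈ ent) (hr₂ : r₂ ∈ ent)
    (hent : ∀ r ∈ ent, r = r₁ ∨ r = r₂)
    (hblind : ∀ W ⊆ U, ∀ X ⊆ ({a, w} : Finset V), A (W ∪ X) = A (W ∩ ent ∪ X)) (b₁ b₂ : Bool) :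
    (∑ W ∈ U.powerset, ν W * rValK A pr ent c a W * cellWt m₁ m₂ b₁ b₂ W) =
      (∑ W ∈ U.powerset, ν W * rValK A pr ent c a W * cellWt m₁ m₂ b₁ b₂ W *
          cellWt r₁ r₂ false false W) +
        A ({r₁} ∪ {a}) *
          (∑ W ∈ U.powerset, ν W * cellWt r₁ r₂ true false W * cellWt m₁ m₂ b₁ b₂ W) +
        A ({r₂} ∪ {a}) *
          (∑ W ∈ U.powerset, ν W * cellWt r₁ r₂ false true W * cellWt m₁ m₂ b₁ b₂ W) +
        A (ent ∪ {a}) *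
          (∑ W ∈ U.powerset, ν W * cellWt r₁ r₂ true true W * cellWt m₁ m₂ b₁ b₂ W) := by
  rw [sum_split_four U (fun W => ν W * rValK A pr ent c a W * cellWt m₁ m₂ b₁ b₂ W) r₁ r₂]
  rw [state_sum_eq U ν (A ({r₁} ∪ {a})) r₁ r₂ m₁ m₂ true false b₁ b₂ _
      (rval_cell_tf U ν A pr ent c r₁ r₂ a w hsure hr₁ hent hblind),
    state_sum_eq U ν (A ({r₂} ∪ {a})) r₁ r₂ m₁ m₂ false true b₁ b₂ _
      (rval_cell_ft U ν A pr ent c r₁ r₂ a w hsure hr₂ hent hblind),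
    state_sum_eq U ν (A (ent ∪ {a})) r₁ r₂ m₁ m₂ true true b₁ b₂ _
      (rval_cell_tt U ν A pr ent c r₁ r₂ a w hsure hr₁ hent hblind)]
  ring

/-- **The entry-state decomposition of the gate's marker-block sums.** -/
theorem G_blocks_eq (U : Finset V) (ν A : Finset V → R) (pr : E → R) (ent : Finset V) (c : V → E)
    (r₁ r₂ m₁ m₂ a w : V) (hsure : ∀ r ∈ ent, pr (c r) = 1) (hr₁ : r₁ ∈ ent) (hr₂ : r₂ ∈ ent)
    (hent : ∀ r ∈ ent, r = r₁ ∨ r = r₂)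
    (hblind : ∀ W ⊆ U, ∀ X ⊆ ({a, w} : Finset V), A (W ∪ X) = A (W ∩ ent ∪ X)) (b₁ b₂ : Bool) :
    (∑ W ∈ U.powerset, ν W * gValK A pr ent c a w W * cellWt m₁ m₂ b₁ b₂ W) =
      (∑ W ∈ U.powerset, ν W * rValK A pr ent c a W * cellWt m₁ m₂ b₁ b₂ W *
          cellWt r₁ r₂ false false W) +
        A ({r₁} ∪ {a, w}) *
          (∑ W ∈ U.powerset, ν W * cellWt r₁ r₂ true false W * cellWt m₁ m₂ b₁ b₂ W) +
        A ({r₂} ∪ {a, w}) *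
          (∑ W ∈ U.powerset, ν W * cellWt r₁ r₂ false true W * cellWt m₁ m₂ b₁ b₂ W) +
        A (ent ∪ {a, w}) *
          (∑ W ∈ U.powerset, ν W * cellWt r₁ r₂ true true W * cellWt m₁ m₂ b₁ b₂ W) := by
  rw [sum_split_four U (fun W => ν W * gValK A pr ent c a w W * cellWt m₁ m₂ b₁ b₂ W) r₁ r₂]
  rw [state_sum_eq U ν (A ({r₁} ∪ {a, w})) r₁ r₂ m₁ m₂ true false b₁ b₂ _
      (gval_cell_tf U ν A pr ent c r₁ r₂ a w hsure hr₁ hent hblind),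
    state_sum_eq U ν (A ({r₂} ∪ {a, w})) r₁ r₂ m₁ m₂ false true b₁ b₂ _
      (gval_cell_ft U ν A pr ent c r₁ r₂ a w hsure hr₂ hent hblind),
    state_sum_eq U ν (A (ent ∪ {a, w})) r₁ r₂ m₁ m₂ true true b₁ b₂ _
      (gval_cell_tt U ν A pr ent c r₁ r₂ a w hsure hr₁ hent hblind)]
  have e : (∑ W ∈ U.powerset, ν W * gValK A pr ent c a w W * cellWt m₁ m₂ b₁ b₂ W *
      cellWt r₁ r₂ false false W) =
      ∑ W ∈ U.powerset, ν W * rValK A pr ent c a W * cellWt m₁ m₂ b₁ b₂ W *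
        cellWt r₁ r₂ false false W := by
    refine Finset.sum_congr rfl fun W _ => ?_
    have := gval_cell_ff ν A pr ent c r₁ r₂ a w hent W
    calc ν W * gValK A pr ent c a w W * cellWt m₁ m₂ b₁ b₂ W * cellWt r₁ r₂ false false W
        = (ν W * gValK A pr ent c a w W * cellWt r₁ r₂ false false W) * cellWt m₁ m₂ b₁ b₂ W := by
          ring
      _ = (ν W * rValK A pr ent c a W * cellWt r₁ r₂ false false W) * cellWt m₁ m₂ b₁ b₂ W := by
          rw [this]
      _ = _ := by ring
  rw [e]
  ring

end K2StateSums

end Summit.Ventures.PercRepro2.Coin
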